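import Summits.ResolutionOfSingularities.ResolutionOfSingularities.Theorems.FrobeniusClosingPatchingRelPerfectPointBlowupChartIterate
import HarnessLib

/-!
# Crux `PatchingRelPerfect` (stmt-ResolutionOfSingularities-16161), chain w52 — rung algebra:
# the graph quotient `K[T_a, T_b, T_c] ⧸ (T_a + T_b T_c) ≅ K[T₀, T₁]` is a regular ring, and the
# chart quotient `B_i ⧸ (x_i, e_a + e_b e_c)`

[OURS · L1 W5.2 · rung tool] Algebra for rung r1e (the first mixed-order non-monomial member
`(x₁³, x₂³, x₃³, x₄³, x₁x₂ + x₃x₄)` of the hard-instance family, CHAIN v1.2): on the Rees chart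
`B_i` of `Bl_𝔪` the residual centre is `(x_i, e_a + e_b e_c)` — the exceptional divisor cut by
the dehomogenised quadric — whose quotient is `κ[T_a,T_b,T_c] ⧸ (T_a + T_b T_c) ≅ κ[T₀, T₁]`,
a regular ring.  PROVED here over any commutative ring `K` resp. any quasi-regular centre:

* `MvPolynomial.isRegularRing_quotient_X_add_X_mul_X` — for a three-element index type
  `{a, b, c}`, `K[T] ⧸ (T_a + T_b T_c)` is a regular ring when `K` is (it is `K[T₀, T₁]`: the
  substitution `T_a ↦ -T₀T₁, T_b ↦ T₀, T_c ↦ T₁` is surjective with kernel `(T_a + T_b T_c)`,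
  the section `T₀ ↦ T_b, T₁ ↦ T_c` showing `p ≡ s(φ p)`);
* `isRegularRing_chartRing_quot_graph` — for a quasi-regular centre `c : Fin n → R` with `R/(c)`
  regular and a chart index `i` whose complement is `{a, b, d}`:
  `B_i ⧸ (c_i, e_a + e_b e_d)` is a regular ring (`chartQuotEquiv` + the above).

Nothing here is a statement of the manuscript under review.

## References

* The Stacks Project, Tags 0804, 0BIQ. [StacksProject]
-/

-- `Summit.<Summit>.<Sub>.Theorems` with `Sub = Summit` (single-conjunct summit, D-0017)
set_option linter.dupNamespace false

noncomputable section

open CategoryTheory CategoryTheory.Limits AlgebraicGeometry Literature.AlgebraicGeometry.Resolution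

namespace Summit.ResolutionOfSingularities.ResolutionOfSingularities.Theorems

universe u

/-! ## `K[T_a, T_b, T_c] ⧸ (T_a + T_b T_c)` is a regular ring -/

section Graph

variable (K : Type u) [CommRing K] {τ : Type} [DecidableEq τ] (a b c : τ)

/-- The substitution `T_a ↦ -T₀T₁`, `T_b ↦ T₀`, everything else `↦ T₁` (local notation, no
definition). -/
local notation3 "graphSubst" K:max a:max b:max =>
  (MvPolynomial.aeval (fun j => if j = a then -(MvPolynomial.X 0 * MvPolynomial.X 1)
    else if j = b then MvPolynomial.X 0 else MvPolynomial.X 1) :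
      MvPolynomial _ K →ₐ[K] MvPolynomial (Fin 2) K)

/-- The section `T₀ ↦ T_b`, `T₁ ↦ T_c` (local notation, no definition). -/
local notation3 "graphSection" K:max b:max c:max =>
  (MvPolynomial.aeval (fun k : Fin 2 => if k = 0 then MvPolynomial.X b else MvPolynomial.X c) :
      MvPolynomial (Fin 2) K →ₐ[K] MvPolynomial _ K)

variable {a b c}

/-- `graphSubst` on `T_a`. [folklore] -/
theorem graphSubst_X_a : (graphSubst K a b) (MvPolynomial.X a) =
    -(MvPolynomial.X 0 * MvPolynomial.X 1) := by
  rw [MvPolynomial.aeval_X, if_pos rfl]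

/-- `graphSubst` on `T_b`. [folklore] -/
theorem graphSubst_X_b (hab : a ≠ b) : (graphSubst K a b) (MvPolynomial.X b) =
    MvPolynomial.X 0 := by
  rw [MvPolynomial.aeval_X, if_neg hab.symm, if_pos rfl]

/-- `graphSubst` on `T_c`. [folklore] -/
theorem graphSubst_X_c (hac : a ≠ c) (hbc : b ≠ c) :
    (graphSubst K a b) (MvPolynomial.X c) = MvPolynomial.X 1 := by
  rw [MvPolynomial.aeval_X, if_neg hac.symm, if_neg hbc.symm]

omit [DecidableEq τ] in
/-- `graphSection` on `T₀`. [folklore] -/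
theorem graphSection_X_zero : (graphSection K b c) (MvPolynomial.X 0) = MvPolynomial.X b := by
  rw [MvPolynomial.aeval_X, if_pos rfl]

omit [DecidableEq τ] in
/-- `graphSection` on `T₁`. [folklore] -/
theorem graphSection_X_one : (graphSection K b c) (MvPolynomial.X 1) = MvPolynomial.X c := by
  rw [MvPolynomial.aeval_X, if_neg (by decide)]

/-- `graphSubst ∘ graphSection = id`. [folklore] -/
theorem graphSubst_graphSection (hab : a ≠ b) (hac : a ≠ c) (hbc : b ≠ c)
    (p : MvPolynomial (Fin 2) K) : (graphSubst K a b) ((graphSection K b c) p) = p := by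
  have h : (graphSubst K a b).comp (graphSection K b c) = AlgHom.id K _ := by
    refine MvPolynomial.algHom_ext fun k => ?_
    rw [AlgHom.comp_apply, AlgHom.id_apply]
    fin_cases k
    · show (graphSubst K a b) ((graphSection K b c) (MvPolynomial.X 0)) = MvPolynomial.X 0
      rw [graphSection_X_zero, graphSubst_X_b K hab]
    · show (graphSubst K a b) ((graphSection K b c) (MvPolynomial.X 1)) = MvPolynomial.X 1
      rw [graphSection_X_one, graphSubst_X_c K hac hbc]
  exact AlgHom.congr_fun h p

/-- **`K[T_a, T_b, T_c] ⧸ (T_a + T_b·T_c)` is a regular ring** (`{a, b, c}` the whole index type,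
`K` a regular ring): it is isomorphic to `K[T₀, T₁]`. [folklore] -/
theorem MvPolynomial.isRegularRing_quotient_X_add_X_mul_X [IsRegularRing K] (hab : a ≠ b)
    (hac : a ≠ c) (hbc : b ≠ c) (huniv : ∀ j : τ, j = a ∨ j = b ∨ j = c) :
    IsRegularRing (MvPolynomial τ K ⧸
      Ideal.span {(MvPolynomial.X a + MvPolynomial.X b * MvPolynomial.X c : MvPolynomial τ K)}) := by
  have hsurj : Function.Surjective (graphSubst K a b : MvPolynomial τ K →+* MvPolynomial (Fin 2) K) :=
    fun p => ⟨(graphSection K b c) p, graphSubst_graphSection K hab hac hbc p⟩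
  -- `p ≡ s (φ p)` modulo `(T_a + T_b T_c)`: the two ring maps agree on generators
  have hcongr : ((Ideal.Quotient.mk (Ideal.span {(MvPolynomial.X a + MvPolynomial.X b *
      MvPolynomial.X c : MvPolynomial τ K)})).comp
        ((graphSection K b c : MvPolynomial (Fin 2) K →+* MvPolynomial τ K).comp
          (graphSubst K a b : MvPolynomial τ K →+* MvPolynomial (Fin 2) K))) =
      Ideal.Quotient.mk _ := by
    refine MvPolynomial.ringHom_ext (fun r => ?_) (fun j => ?_)
    · simp only [RingHom.comp_apply, RingHom.coe_coe, MvPolynomial.algHom_C,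
        MvPolynomial.algebraMap_eq]
    · simp only [RingHom.comp_apply, RingHom.coe_coe]
      rcases huniv j with rfl | rfl | rfl
      · rw [graphSubst_X_a, map_neg, map_mul, graphSection_X_zero, graphSection_X_one, eq_comm,
          Ideal.Quotient.eq, sub_neg_eq_add]
        exact Ideal.subset_span rfl
      · rw [graphSubst_X_b K hab, graphSection_X_zero]
      · rw [graphSubst_X_c K hac hbc, graphSection_X_one]
  have hker : RingHom.ker (graphSubst K a b : MvPolynomial τ K →+* MvPolynomial (Fin 2) K) =
      Ideal.span {(MvPolynomial.X a + MvPolynomial.X b * MvPolynomial.X c : MvPolynomial τ K)} := by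
    apply le_antisymm
    · intro p hp
      rw [RingHom.mem_ker] at hp
      have h1 := congrArg (fun f : MvPolynomial τ K →+* _ => f p) hcongr
      simp only [RingHom.comp_apply] at h1
      rw [hp, map_zero, map_zero] at h1
      exact Ideal.Quotient.eq_zero_iff_mem.mp h1.symm
    · rw [Ideal.span_le, Set.singleton_subset_iff, SetLike.mem_coe, RingHom.mem_ker,
        RingHom.coe_coe, map_add, map_mul, graphSubst_X_a, graphSubst_X_b K hab,
        graphSubst_X_c K hac hbc, neg_add_cancel]
  have e := (Ideal.quotEquivOfEq hker.symm).trans (RingHom.quotientKerEquivOfSurjective hsurj)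
  exact IsRegularRing.of_ringEquiv e.symm

end Graph

/-! ## The chart quotient `B_i ⧸ (c_i, e_a + e_b e_d)` -/

section Chart

variable {R : Type u} [CommRing R] {n : ℕ} (c : Fin n → R) (i : Fin n)
  (a b d : {j : Fin n // j ≠ i})

local notation3 "KA" => Ideal.span {chartBase c i (c i)}
local notation3 "Pq" => MvPolynomial {j : Fin n // j ≠ i} (R ⧸ Ideal.span (Set.range c))
local notation3 "Hq" => (MvPolynomial.X a + MvPolynomial.X b * MvPolynomial.X d :
  MvPolynomial {j : Fin n // j ≠ i} (R ⧸ Ideal.span (Set.range c)))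
local notation3 "hq" => (chartGen c i a.1 + chartGen c i b.1 * chartGen c i d.1)

set_option maxHeartbeats 400000 in
/-- **`B_i ⧸ (c_i, e_a + e_b·e_d)` is a regular ring** when `c` is quasi-regular, `R/(c)` is a
regular ring and `{a, b, d}` are the three indices other than `i`:
`B_i ⧸ (c_i) ≅ (R/I)[T_a, T_b, T_d]` (`chartQuotEquiv`) and the graph quotient is `(R/I)[T₀,T₁]`.
[cite: StacksProject, Tag 0BIQ] -/
theorem isRegularRing_chartRing_quot_graph (hc : IsQuasiRegular c)
    [IsRegularRing (R ⧸ Ideal.span (Set.range c))] (hab : a ≠ b) (had : a ≠ d) (hbd : b ≠ d)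
    (huniv : ∀ j : {j : Fin n // j ≠ i}, j = a ∨ j = b ∨ j = d) :
    IsRegularRing (chartRing c i ⧸ Ideal.span {chartBase c i (c i), hq}) := by
  classical
  have hεH : chartQuotEquiv c i hc Hq = Ideal.Quotient.mk KA hq := by
    rw [map_add, map_mul, chartQuotEquiv_apply, chartQuotEquiv_apply, chartQuotEquiv_apply,
      chartQuotMap_X, chartQuotMap_X, chartQuotMap_X, map_add, map_mul]
  have hK₀map : (Ideal.span {chartBase c i (c i), hq}).map (Ideal.Quotient.mk KA) =
      (Ideal.span {Hq}).map (chartQuotEquiv c i hc : Pq →+* chartRing c i ⧸ KA) := by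
    have h0 : Ideal.Quotient.mk KA (chartBase c i (c i)) = 0 :=
      Ideal.Quotient.eq_zero_iff_mem.mpr (Ideal.subset_span rfl)
    rw [Ideal.map_span, Set.image_insert_eq, Set.image_singleton, Ideal.map_span,
      Set.image_singleton, RingHom.coe_coe, hεH, h0, Ideal.span_insert,
      Ideal.span_singleton_eq_bot.mpr rfl, bot_sup_eq]
  haveI := MvPolynomial.isRegularRing_quotient_X_add_X_mul_X (R ⧸ Ideal.span (Set.range c))
    hab had hbd huniv
  have e2 : (chartRing c i ⧸ KA) ⧸ (Ideal.span {chartBase c i (c i), hq}).map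
      (Ideal.Quotient.mk KA) ≃+* Pq ⧸ Ideal.span {Hq} :=
    (Ideal.quotientEquiv (Ideal.span {Hq}) _ (chartQuotEquiv c i hc) hK₀map).symm
  have hle : KA ≤ Ideal.span {chartBase c i (c i), hq} := by
    rw [Ideal.span_singleton_le_iff_mem]
    exact Ideal.subset_span (Set.mem_insert _ _)
  have e1 := (DoubleQuot.quotQuotEquivQuotOfLE hle).symm
  exact IsRegularRing.of_ringEquiv (R := Pq ⧸ Ideal.span {Hq}) (e2.symm.trans e1.symm)

end Chart

end Summit.ResolutionOfSingularities.ResolutionOfSingularities.Theorems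

end
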